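import Summits.CriticalPhenomena.PercolationContinuityZ3.Theorems.PercNearOneGluingNoHeavyLowerTailTerminalTwoSumSums
import Summits.CriticalPhenomena.PercolationContinuityZ3.Theorems.PercNearOneGluingNoHeavyLowerTailApexTwoSum
import HarnessLib

/-!
# `NoHeavyLowerTail` (stmt-CriticalPhenomena-4575) — 2-SUMS THROUGH A TERMINAL FOR R1 AT THE MEASURE LEVEL (the `{b, v}`-cut):
# R1 ∧ LG on the far piece ⟹ R1 on the graph glued along `{b, v}`, for every `φ_{𝐩,q}`, every `q > 0`

Support file (prover prim-gen-kcluster gen 72; `--supports stmt-CriticalPhenomena-4575`).  No definitions, no named facts, no sorries.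
This is the kernel MEASURE-LEVEL form of KCLUSTER-gen69 §5.2(b) / THEOREM-3SUM Prop. 4.2 ("a minimal counterexample to R1-RC(q ≥ 1) has no 2-cut
`{b, v}` through a terminal"), whose algebraic core was `WheelR1.bv_cut_certificate` (p375044).

SETTING.  Apex `a`, terminals `b, c`, hub `v` (distinct); supports `DX` (containing the apex side: `a` private to `DX`) and `DY` (containing `c`,
private) MEETING ONLY IN `{v, b}`; `w` vanishing off `DX ∪ DY`, `wX = w·1_{DX}`, `wY = w·1_{DXᶜ}`; `φ = rcMeasureW w q ∅`, `φ_Y = rcMeasureW wY q ∅`.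
Cells of the far piece for the instance `(v; b, c)` with support `DY` (vocabulary of `ThreeSum`): `T = {b, c ∈ C(v)}`, `U_b`, `U_c`,
`U_a = {b, c ∉ C(v), c ∈ C(b)}`, `S = {b, c ∉ C(v), C(v) cuts b|c in DY}`, `N = {pairwise apart, not cut}`.

**THEOREM** (`TerminalTwoSum.r1_of_terminalTwoSum`, every `q > 0`).  If `φ_Y` satisfies R1 `φ(T)φ(S) ≤ φ(U_b)φ(U_c)` and LG `φ(S)φ(U_a) ≤ φ(N)φ(U_c)`
for `(v; b, c)`, and `b, c` are joined in the support `DY`, then `φ` satisfies R1 for `(a; b, c)` (support `D = DX ∪ DY`).  Nothing is assumed about the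
apex piece `X`.  PROOF: dictionary (part 4) and the identity `U_bU_c − TS = q·X3·[X1(ρ + λ) + X2 ρ + qX2(Yuc² + YucYs + λ) + X3 ρ]` with
`ρ = YubYuc − YtYs ≥ 0` (R1) and `λ = YnYuc − YsYua ≥ 0` (LG).  For `q ≥ 1`, LG follows from R1 on the piece (`ThreeSum.lb_lg_of_r1`, gen 71).
-/

noncomputable section

namespace Summit.CriticalPhenomena.PercolationContinuityZ3.Theorems

namespace TerminalTwoSum

open Finset SimpleGraph Literature.Probability.Percolation Literature.Probability.Percolation.Gladkov
open Literature.Probability.Percolation.BHK2006 (weight)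
open Literature.Probability.Percolation.DecisionTree (ind ind_of_mem ind_of_not_mem ind_nonneg)
open Literature.Probability.LatticeModels RefinedRowR3 ThreePointLB MeasureTheory
open scoped Classical

variable {V : Type*} [Fintype V]

section Main

variable {DX DY D : Finset (Sym2 V)} {a b c v : V} (hab : a ≠ b) (hav : a ≠ v) (hac : a ≠ c) (hbc : b ≠ c) (hvc : v ≠ c)
  (hvb : v ≠ b)
  (hsepD : ∀ x : V, (∃ e ∈ DX, x ∈ e) → (∃ e ∈ DY, x ∈ e) → (x = v ∨ x = b))
  (haY : ∀ e ∈ DY, a ∉ e) (hcX : ∀ e ∈ DX, c ∉ e) (hD : ∀ e, e ∈ D ↔ e ∈ DX ∨ e ∈ DY)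
  (w wX wY : Sym2 V → unitInterval) {q : ℝ} (hq : 0 < q)
  (hw : ∀ e, e ∉ (↑DX ∪ ↑DY : Set (Sym2 V)) → (w e : ℝ) = 0)
  (hX : ∀ e ∈ (↑DX : Set (Sym2 V)), wX e = w e) (hX' : ∀ e ∉ (↑DX : Set (Sym2 V)), wX e = 0)
  (hY : ∀ e ∈ (↑DX : Set (Sym2 V)), wY e = 0) (hY' : ∀ e ∉ (↑DX : Set (Sym2 V)), wY e = w e)
include hab hav hac hbc hvc hvb hsepD haY hcX hD hq hw hX hX' hY hY'

/-- **The 2-sum theorem through a terminal (the `{b, v}`-cut) for R1, measure level** (every `q > 0`; see the module docstring).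
[this work] -/
theorem r1_of_terminalTwoSum (HY : c ∈ cl DY b)
    (hR1Y : (rcMeasureW wY q ∅).real {η : BondConfig V | b ∈ cl η.toFinset v ∧ c ∈ cl η.toFinset v} * (rcMeasureW wY q ∅).real {η : BondConfig V | b ∉ cl η.toFinset v ∧ c ∉ cl η.toFinset v ∧ Sep DY (cl η.toFinset v) b c} ≤ (rcMeasureW wY q ∅).real {η : BondConfig V | b ∈ cl η.toFinset v ∧ c ∉ cl η.toFinset v} * (rcMeasureW wY q ∅).real {η : BondConfig V | b ∉ cl η.toFinset v ∧ c ∈ cl η.toFinset v})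
    (hLGY : (rcMeasureW wY q ∅).real {η : BondConfig V | b ∉ cl η.toFinset v ∧ c ∉ cl η.toFinset v ∧ Sep DY (cl η.toFinset v) b c} * (rcMeasureW wY q ∅).real {η : BondConfig V | b ∉ cl η.toFinset v ∧ c ∉ cl η.toFinset v ∧ c ∈ cl η.toFinset b} ≤ (rcMeasureW wY q ∅).real {η : BondConfig V | b ∉ cl η.toFinset v ∧ c ∉ cl η.toFinset v ∧ c ∉ cl η.toFinset b ∧ ¬ Sep DY (cl η.toFinset v) b c} * (rcMeasureW wY q ∅).real {η : BondConfig V | b ∉ cl η.toFinset v ∧ c ∈ cl η.toFinset v}) :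
    (rcMeasureW w q ∅).real {η : BondConfig V | b ∈ cl η.toFinset a ∧ c ∈ cl η.toFinset a} * (rcMeasureW w q ∅).real {η : BondConfig V | b ∉ cl η.toFinset a ∧ c ∉ cl η.toFinset a ∧ Sep D (cl η.toFinset a) b c} ≤ (rcMeasureW w q ∅).real {η : BondConfig V | b ∈ cl η.toFinset a ∧ c ∉ cl η.toFinset a} * (rcMeasureW w q ∅).real {η : BondConfig V | b ∉ cl η.toFinset a ∧ c ∈ cl η.toFinset a} := by
  have hDD : D = DX ∪ DY := by ext e; rw [Finset.mem_union]; exact hD e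
  subst hDD
  have hZ := rcPartitionFunctionW_pos w hq (∅ : Set V)
  have hZY := rcPartitionFunctionW_pos wY hq (∅ : Set V)
  have hK : 0 < q ^ clusterCount (∅ : BondConfig V) ({v, b} : Set V) := pow_pos hq _
  have hnn : ∀ (u : Sym2 V → unitInterval) (E : Set (BondConfig V)),
      0 ≤ ∑ η : BondConfig V, rcWeightW u q ({v, b} : Set V) η * ind E η := fun u E =>
    Finset.sum_nonneg fun η _ => mul_nonneg (rcWeightW_nonneg u hq.le _ η) (ind_nonneg E η)
  simp only [rcMeasureW_real_eq_sum_div w hq, rcMeasureW_real_eq_sum_div wY hq] at hR1Y hLGY ⊢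
  rw [ApexTwoSum.free_eq_wired hvb wY q (E := {η : BondConfig V | b ∈ cl η.toFinset v ∧ c ∈ cl η.toFinset v}) (fun η hη => hη.1),
    ApexTwoSum.free_eq_q_wired hvb wY q (E := {η : BondConfig V | b ∉ cl η.toFinset v ∧ c ∉ cl η.toFinset v ∧ Sep DY (cl η.toFinset v) b c}) (fun η hη => hη.1),
    ApexTwoSum.free_eq_wired hvb wY q (E := {η : BondConfig V | b ∈ cl η.toFinset v ∧ c ∉ cl η.toFinset v}) (fun η hη => hη.1),
    ApexTwoSum.free_eq_q_wired hvb wY q (E := {η : BondConfig V | b ∉ cl η.toFinset v ∧ c ∈ cl η.toFinset v}) (fun η hη => hη.1)] at hR1Y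
  rw [ApexTwoSum.free_eq_q_wired hvb wY q (E := {η : BondConfig V | b ∉ cl η.toFinset v ∧ c ∉ cl η.toFinset v ∧ Sep DY (cl η.toFinset v) b c}) (fun η hη => hη.1),
    ApexTwoSum.free_eq_q_wired hvb wY q (E := {η : BondConfig V | b ∉ cl η.toFinset v ∧ c ∉ cl η.toFinset v ∧ c ∈ cl η.toFinset b}) (fun η hη => hη.1),
    ApexTwoSum.free_eq_q_wired hvb wY q (E := {η : BondConfig V | b ∉ cl η.toFinset v ∧ c ∉ cl η.toFinset v ∧ c ∉ cl η.toFinset b ∧ ¬ Sep DY (cl η.toFinset v) b c}) (fun η hη => hη.1),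
    ApexTwoSum.free_eq_q_wired hvb wY q (E := {η : BondConfig V | b ∉ cl η.toFinset v ∧ c ∈ cl η.toFinset v}) (fun η hη => hη.1)] at hLGY
  rw [div_mul_div_comm, div_mul_div_comm]
  refine div_le_div_of_nonneg_right ?_ (mul_pos hZ hZ).le
  refine le_of_mul_le_mul_right (a := q ^ clusterCount (∅ : BondConfig V) ({v, b} : Set V) * q ^ clusterCount (∅ : BondConfig V) ({v, b} : Set V)) ?_ (mul_pos hK hK)
  have eT := glued_T_sum hab hav hac hbc hvc hvb hsepD haY hcX w wX wY q hw hX hX' hY hY'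
  have eS := glued_S_sum hab hav hac hbc hvc hvb hsepD haY hcX w wX wY q hw hX hX' hY hY' HY
  have eUb := glued_Ub_sum hab hav hac hbc hvc hvb hsepD haY hcX w wX wY q hw hX hX' hY hY'
  have eUc := glued_Uc_sum hab hav hac hbc hvc hvb hsepD haY hcX w wX wY q hw hX hX' hY hY'
  rw [show ∀ x y K : ℝ, x * y * (K * K) = (x * K) * (y * K) from fun x y K => by ring, eT, eS,
    show ∀ x y K : ℝ, x * y * (K * K) = (x * K) * (y * K) from fun x y K => by ring, eUb, eUc]
  set X1 := (∑ η : BondConfig V, rcWeightW wX q ({v, b} : Set V) η * ind {η : BondConfig V | b ∈ cl η.toFinset a ∧ v ∈ cl η.toFinset a} η) with hX1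
  set X2 := (∑ η : BondConfig V, rcWeightW wX q ({v, b} : Set V) η * ind {η : BondConfig V | b ∈ cl η.toFinset a ∧ v ∉ cl η.toFinset a} η) with hX2
  set X3 := (∑ η : BondConfig V, rcWeightW wX q ({v, b} : Set V) η * ind {η : BondConfig V | b ∉ cl η.toFinset a ∧ v ∈ cl η.toFinset a} η) with hX3
  set Yt := (∑ η : BondConfig V, rcWeightW wY q ({v, b} : Set V) η * ind {η : BondConfig V | b ∈ cl η.toFinset v ∧ c ∈ cl η.toFinset v} η) with hYt
  set Yb := (∑ η : BondConfig V, rcWeightW wY q ({v, b} : Set V) η * ind {η : BondConfig V | b ∈ cl η.toFinset v ∧ c ∉ cl η.toFinset v} η) with hYb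
  set Yc := (∑ η : BondConfig V, rcWeightW wY q ({v, b} : Set V) η * ind {η : BondConfig V | b ∉ cl η.toFinset v ∧ c ∈ cl η.toFinset v} η) with hYc
  set Ya := (∑ η : BondConfig V, rcWeightW wY q ({v, b} : Set V) η * ind {η : BondConfig V | b ∉ cl η.toFinset v ∧ c ∉ cl η.toFinset v ∧ c ∈ cl η.toFinset b} η) with hYa
  set Ys := (∑ η : BondConfig V, rcWeightW wY q ({v, b} : Set V) η * ind {η : BondConfig V | b ∉ cl η.toFinset v ∧ c ∉ cl η.toFinset v ∧ Sep DY (cl η.toFinset v) b c} η) with hYs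
  set Yn := (∑ η : BondConfig V, rcWeightW wY q ({v, b} : Set V) η * ind {η : BondConfig V | b ∉ cl η.toFinset v ∧ c ∉ cl η.toFinset v ∧ c ∉ cl η.toFinset b ∧ ¬ Sep DY (cl η.toFinset v) b c} η) with hYn
  have hZY2 : 0 < rcPartitionFunctionW wY q ∅ * rcPartitionFunctionW wY q ∅ := mul_pos hZY hZY
  have ρ : 0 ≤ Yb * Yc - Yt * Ys := by
    rw [div_mul_div_comm, div_mul_div_comm, div_le_div_iff_of_pos_right hZY2] at hR1Y
    have e1 : Yt * (q * Ys) = q * (Yt * Ys) := by ring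
    have e2 : Yb * (q * Yc) = q * (Yb * Yc) := by ring
    rw [e1, e2] at hR1Y
    have h3 := le_of_mul_le_mul_left hR1Y hq
    linarith
  have lam : 0 ≤ Yn * Yc - Ys * Ya := by
    rw [div_mul_div_comm, div_mul_div_comm, div_le_div_iff_of_pos_right hZY2] at hLGY
    have e1 : q * Ys * (q * Ya) = q * q * (Ys * Ya) := by ring
    have e2 : q * Yn * (q * Yc) = q * q * (Yn * Yc) := by ring
    rw [e1, e2] at hLGY
    have h3 := le_of_mul_le_mul_left hLGY (mul_pos hq hq)
    linarith
  have key : (X1 * Yb + X1 * Ys + X1 * Yn + X2 * Yb + q * (X2 * Yc) + q * (X2 * Ys) + q * (X2 * Yn) + X3 * Yb) * (q * (X3 * Yc)) -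
      (X1 * Yt + X1 * Yc + X1 * Ya + X2 * Yt + X3 * Yt + q * (X2 * Ya)) * (q * (X3 * Ys)) =
      q * X3 * (X1 * ((Yb * Yc - Yt * Ys) + (Yn * Yc - Ys * Ya)) + X2 * (Yb * Yc - Yt * Ys) +
        q * X2 * (Yc * Yc + Yc * Ys + (Yn * Yc - Ys * Ya)) + X3 * (Yb * Yc - Yt * Ys)) := by
    ring
  have hfin : 0 ≤ q * X3 * (X1 * ((Yb * Yc - Yt * Ys) + (Yn * Yc - Ys * Ya)) + X2 * (Yb * Yc - Yt * Ys) +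
        q * X2 * (Yc * Yc + Yc * Ys + (Yn * Yc - Ys * Ya)) + X3 * (Yb * Yc - Yt * Ys)) := by
    have h1 : 0 ≤ X1 := hnn _ _
    have h2 : 0 ≤ X2 := hnn _ _
    have h3 : 0 ≤ X3 := hnn _ _
    have h4 : 0 ≤ Yc := hnn _ _
    have h5 : 0 ≤ Ys := hnn _ _
    have i1 : 0 ≤ X1 * ((Yb * Yc - Yt * Ys) + (Yn * Yc - Ys * Ya)) := mul_nonneg h1 (add_nonneg ρ lam)
    have i2 : 0 ≤ X2 * (Yb * Yc - Yt * Ys) := mul_nonneg h2 ρ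
    have i3 : 0 ≤ q * X2 * (Yc * Yc + Yc * Ys + (Yn * Yc - Ys * Ya)) :=
      mul_nonneg (mul_nonneg hq.le h2) (add_nonneg (add_nonneg (mul_nonneg h4 h4) (mul_nonneg h4 h5)) lam)
    have i4 : 0 ≤ X3 * (Yb * Yc - Yt * Ys) := mul_nonneg h3 ρ
    exact mul_nonneg (mul_nonneg hq.le h3) (add_nonneg (add_nonneg (add_nonneg i1 i2) i3) i4)
  linarith [key, hfin]

end Main

end TerminalTwoSum

end Summit.CriticalPhenomena.PercolationContinuityZ3.Theorems
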